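import Literature.Algebra.Lie.LagrangianSplittingJordanLefschetzPair
import Literature.Algebra.Lie.LefschetzModuleAdjoint
import HarnessLib

/-!
# Looijenga–Lunts (2.9), cases `(C_m, A_{m-1})` and `(D_{2m}, A_{2m-1})`, BASIS-FREE: the graded pieces `𝔤_0`, `𝔤_{±2}` of the splitting grading and "`𝔤_{±2} ≅` the symmetric (resp. skew) elements of `(V_{±1})^{⊗2}`"

Topic `Literature/Algebra/Lie` (namespace `Literature.Algebra.Lie.LagrangianSplittingGrading`, continued).  Lane
`lit-hodgefound` (Track 2 foundations library), skeleton seat `lit-hodgefound-skel-1` (generation 52), row **A1-207** of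
`run/shared/lean/pub/lit-hodgefound/SKELETON.md`.  Row A1-204 proved, basis-free, that a splitting `V = V_1 ⊕ V_{-1}`
of a non-degenerate `ε`-symmetric space `(V, B)` into complementary totally isotropic subspaces grades `𝔰𝔭(V, B)` /
`𝔰𝔬(V, B)` into a Jordan–Lefschetz pair by `h = 1_{V_1} - 1_{V_{-1}}`, and row A1-206 proved the first clause of
(2.9)'s description of the pieces, "`𝔤_0` maps isomorphically to `𝔤𝔩(V_1)`".  This file proves the remaining clauses
AS PRINTED and without coordinates (rows A1-190 / A1-192 have them only as matrix-block descriptions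
`(0 B; 0 0)`, `Bᵀ = ±B`, in a hyperbolic basis):

* the three degrees POSITIONALLY: `𝔤_0 = {y | y V_{±1} ⊆ V_{±1}}`, `𝔤_2 = {y | y V ⊆ V_1, y V_1 = 0}` (the corner
  `V_{-1} → V_1`), `𝔤_{-2} = {y | y V ⊆ V_{-1}, y V_{-1} = 0}` — over a field of characteristic `0`;
* "`𝔤_{±2}` is naturally isomorphic to the space of symmetric elements in `(V_{±1})^{⊗2}`" (symplectic case) /
  "`𝔤_{±2}` maps onto the skew elements in `(V_{±1})^{⊗2}`" (orthogonal case), rendered through "the obvious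
  isomorphism `V_{-1} ≅ V_1^*`" as: **`y ↦ β_y`, `β_y(a, b) = B(a, y b)` for `a, b ∈ V_{-1}`, is a bijection from `𝔤_2`
  onto the bilinear forms `β` on `V_{-1}` with `β(a, b) = -ε β(b, a)`** — the SYMMETRIC forms for `B` alternating
  (`ε = -1`, `𝔤 = 𝔰𝔭(V)`: `Sym²(V_{-1}^*) = Sym²(V_1)`), the SKEW forms for `B` symmetric (`ε = 1`, `𝔤 = 𝔰𝔬(V)`:
  `Λ²(V_{-1}^*) = Λ²(V_1)`); and the same for `𝔤_{-2}` with forms on `V_1`.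

Method (as in row A1-206): the eigen-equation `[h, y] = c y` evaluated on `V_1` and `V_{-1}` (`h² = 1`), injectivity by
non-degeneracy and isotropy, and an explicit skew-adjoint extension `y = e⁻¹ ∘ β ∘ pr_{V_{-1}}` through the right
pairing `e : V_1 ≅ V_{-1}^*`, whose skew-adjointness is exactly the `(-ε)`-symmetry of `β`.  Any field of
characteristic `0` (no algebraic closedness), `V` finite-dimensional for surjectivity.  THEOREMS ONLY (no definition,
no named fact, no `sorry`; net debt `0`).

## Source, VERBATIM

E. Looijenga, V. A. Lunts, *A Lie algebra attached to a projective variety*, Invent. Math. **129** (1997) 361–412 (held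
TeX `paper:arxiv-alg-geom_9604014`), (2.9) p. 10 L105–L113: "Case `(C_m, A_{m-1})`: `(𝔰𝔭(2m), 𝔰𝔩(m))` (`m ≥ 2`).
Let `V` be a vector space of dimension `2m` equipped with a nondegenerate symplectic form and let `V = V_{-1} ⊕ V_1`
be a decomposition of `V` into totally isotropic subspaces of dimension `m`.  We take `𝔤 = 𝔰𝔭(V)` and let
`h ∈ 𝔰𝔭(V)` be the element with the eigen space decomposition `V_{-1} ⊕ V_1`.  Then `𝔤_0` maps isomorphically to
`𝔤𝔩(V_1)` and `𝔤_{±2}` is naturally isomorphic to the space of symmetric elements in `(V_{±1})^{⊗2}`."; p. 11 L1–L8: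
"Case `(D_{2m}, A_{2m-1})`: `(𝔰𝔬(4m), 𝔰𝔩(2m))` (`m ≥ 2`).  Let `V` be a vector space of dimension `4m` equipped with
a nondegenerate symmetric bilinear form and let `V = V_{-1} ⊕ V_1` be a decomposition of `V` into totally isotropic
subspaces of dimension `2m`.  We take `𝔤 = 𝔰𝔬(V)` and let `h ∈ 𝔰𝔬(V)` be the element with the eigen space
decomposition `V_{-1} ⊕ V_1`.  Then `𝔤_0` maps isomorphically to `𝔤𝔩(V_1)` and `𝔤_{±2}` maps onto the skew elements
in `(V_{±1})^{⊗2}`."; p. 11 L11–L12: "the obvious isomorphism `V_{-1} ≅ V_1^*`"; §1 p. 3 L106–L111: "a linear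
transformation `u : M → M` has degree `k` if and only if `[h, u] = ku`."

## Contents (all proved)

* §8 `mem_adDegree_iff_apply` (`y ∈ 𝔤_c(x) ⟺ ∀ v, x(yv) - y(xv) = c·yv` in `𝔰𝔬/𝔰𝔭(V, B)`), `apply_apply_eq_self`
  (`h² = 1`);
* §9 **`mem_adDegree_zero_iff_apply_mem`**, `mem_adDegree_two_of_apply`, **`mem_adDegree_two_iff_apply`**,
  **`mem_adDegree_neg_two_iff_apply`** (the three degrees positionally; characteristic `0`);
* §10 `apply_right_eq_of_mem_skewAdjoint` (`β_y` is `(-ε)`-symmetric for every skew-adjoint `y`),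
  `eq_zero_of_apply_mem_of_forall_right` / `eq_zero_of_mem_adDegree_two_of_forall_right` (injectivity of `y ↦ β_y`
  on `𝔤_2`), `bijective_flip_domRestrict₁₂` (`V_1 ≅ V_{-1}^*`), **`exists_mem_adDegree_two_apply_eq`** (surjectivity),
  **`existsUnique_mem_adDegree_two_apply_eq`** (the bijection; `_of_isAlt`: `𝔤_2 ≅ Sym²` for `𝔰𝔭`; `_of_isSymm`:
  `𝔤_2 ≅ Λ²` for `𝔰𝔬`), **`existsUnique_mem_adDegree_neg_two_apply_eq`** (`𝔤_{-2}`, by `V_1 ↔ V_{-1}`, `h ↔ -h`).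

## SCOPE (what is NOT formalised here)

No `LinearEquiv` is bundled (the bijections are stated as `∃!` with the explicit positional inverse description); the
tensor squares `(V_{±1})^{⊗2}` themselves are not introduced — "symmetric / skew elements of `V_1 ⊗ V_1`" is rendered as
"symmetric / skew bilinear forms on `V_{-1} ≅ V_1^*`"; the fundamental representations `M` of (2.9) are not touched.

## References

* [LooijengaLunts1997] E. Looijenga, V. A. Lunts, *A Lie algebra attached to a projective variety*, Invent. Math. 129
  (1997) 361–412; arXiv:alg-geom/9604014. §2 (2.9) p. 10 L105–L113, p. 11 L1–L12; §1 p. 3 L106–L111 (held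
  `paper:arxiv-alg-geom_9604014`).
-/

namespace Literature.Algebra.Lie.LagrangianSplittingGrading

open Module LieAlgebra Function Literature.Algebra.Lie

variable {K : Type*} [Field K] {V : Type*} [AddCommGroup V] [Module K V] {B : LinearMap.BilinForm K V}
  {L L' : Submodule K V}

/-! ### §8 The eigen-equation `[h, y] = c y` on vectors; `h² = 1` -/

/-- For `x y ∈ 𝔰𝔬/𝔰𝔭(V, B)` and `c ∈ K`: `y ∈ 𝔤_c(x)` iff `x(yv) - y(xv) = c · yv` for every `v ∈ V`. [cite: LooijengaLunts1997, §1 p0003 L106–L111 ("u has degree k if and only if [h, u] = ku")] -/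
theorem mem_adDegree_iff_apply (x y : skewAdjointLieSubalgebra B) (c : K) :
    y ∈ adDegree K x c ↔
      ∀ v, (x : Module.End K V) ((y : Module.End K V) v) - (y : Module.End K V) ((x : Module.End K V) v) =
        c • (y : Module.End K V) v := by
  letI : LieRing (Module.End K V) := LieRing.ofAssociativeRing
  rw [mem_adDegree_iff, Subtype.ext_iff, LieSubalgebra.coe_bracket, SetLike.val_smul, Ring.lie_def, LinearMap.ext_iff]
  simp only [LinearMap.sub_apply, Module.End.mul_apply, LinearMap.smul_apply]

/-- `h² = 1`: `x(xw) = w` for `x = 1_L - 1_{L'}`. [cite: LooijengaLunts1997, §2 (2.9) p. 10 L105–L111 ("the element with the eigen space decomposition V_{-1} ⊕ V_1")] -/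
theorem apply_apply_eq_self (hLL' : IsCompl L L') (x : Module.End K V) (hxL : ∀ v ∈ L, x v = v)
    (hxL' : ∀ v ∈ L', x v = -v) (w : V) : x (x w) = w := by
  conv_lhs => rw [← Submodule.projection_add_projection_eq_self hLL' w]
  conv_rhs => rw [← Submodule.projection_add_projection_eq_self hLL' w]
  rw [map_add, hxL _ (Submodule.projection_apply_mem hLL' w), hxL' _ (Submodule.projection_apply_mem hLL'.symm w),
    map_add, map_neg, hxL _ (Submodule.projection_apply_mem hLL' w),
    hxL' _ (Submodule.projection_apply_mem hLL'.symm w), neg_neg]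

/-! ### §9 `𝔤_0`, `𝔤_2`, `𝔤_{-2}` positionally: block-diagonal, upper corner `V_{-1} → V_1`, lower corner -/

section Positional

variable [CharZero K]

/-- **`𝔤_0 = {y | y V_1 ⊆ V_1, y V_{-1} ⊆ V_{-1}}`** (the block-diagonal part). [cite: LooijengaLunts1997, §2 (2.9) p. 10 L105–L111 ("Then 𝔤_0 maps isomorphically to 𝔤𝔩(V_1)"), p. 11 L1–L7] -/
theorem mem_adDegree_zero_iff_apply_mem (hLL' : IsCompl L L') (x : skewAdjointLieSubalgebra B)
    (hxL : ∀ v ∈ L, (x : Module.End K V) v = v) (hxL' : ∀ v ∈ L', (x : Module.End K V) v = -v)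
    (y : skewAdjointLieSubalgebra B) :
    y ∈ adDegree K x 0 ↔ (∀ v ∈ L, (y : Module.End K V) v ∈ L) ∧ ∀ v ∈ L', (y : Module.End K V) v ∈ L' := by
  refine ⟨apply_mem_of_mem_adDegree_zero hLL' x hxL hxL' y, fun ⟨h1, h2⟩ ↦ ?_⟩
  rw [mem_adDegree_zero_iff_commute]
  intro v
  conv_lhs => rw [← Submodule.projection_add_projection_eq_self hLL' v]
  conv_rhs => rw [← Submodule.projection_add_projection_eq_self hLL' v]
  have hv₁ := Submodule.projection_apply_mem hLL' v
  have hv₂ := Submodule.projection_apply_mem hLL'.symm v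
  rw [map_add, map_add, hxL _ (h1 _ hv₁), hxL' _ (h2 _ hv₂), map_add, hxL _ hv₁, hxL' _ hv₂, map_add, map_neg]

omit [CharZero K] in
/-- Degree `2` from the position alone (no hypothesis on `K`): if `y V ⊆ V_1` and `y V_1 = 0` then `[h, y] = 2y`. [cite: LooijengaLunts1997, §2 (2.9) p. 10 L111–L113 ("𝔤_{±2} is naturally isomorphic to the space of symmetric elements in (V_{±1})^{⊗2}"), p. 11 L6–L8] -/
theorem mem_adDegree_two_of_apply (hLL' : IsCompl L L') (x : skewAdjointLieSubalgebra B)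
    (hxL : ∀ v ∈ L, (x : Module.End K V) v = v) (hxL' : ∀ v ∈ L', (x : Module.End K V) v = -v)
    (y : skewAdjointLieSubalgebra B) (h1 : ∀ v, (y : Module.End K V) v ∈ L) (h2 : ∀ v ∈ L, (y : Module.End K V) v = 0) :
    y ∈ adDegree K x 2 := by
  rw [mem_adDegree_iff_apply]
  intro v
  have hdec := Submodule.projection_add_projection_eq_self hLL' v
  set v₁ := L.projection L' hLL' v
  set v₂ := L'.projection L hLL'.symm v
  have hv₁ : v₁ ∈ L := Submodule.projection_apply_mem hLL' v
  have hv₂ : v₂ ∈ L' := Submodule.projection_apply_mem hLL'.symm v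
  have hYv : (y : Module.End K V) v = (y : Module.End K V) v₂ := by
    conv_lhs => rw [← hdec]
    rw [map_add, h2 _ hv₁, zero_add]
  have hXv : (x : Module.End K V) v = v₁ - v₂ := by
    conv_lhs => rw [← hdec]
    rw [map_add, hxL _ hv₁, hxL' _ hv₂, sub_eq_add_neg]
  rw [hxL _ (h1 v), hXv, map_sub, h2 _ hv₁, zero_sub, ← hYv, sub_neg_eq_add, two_smul]

/-- **`𝔤_2 = {y | y V ⊆ V_1, y V_1 = 0}`** (the corner `V_{-1} → V_1`; `K` of characteristic `0`). [cite: LooijengaLunts1997, §2 (2.9) p. 10 L111–L113, p. 11 L6–L8] -/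
theorem mem_adDegree_two_iff_apply (hLL' : IsCompl L L') (x : skewAdjointLieSubalgebra B)
    (hxL : ∀ v ∈ L, (x : Module.End K V) v = v) (hxL' : ∀ v ∈ L', (x : Module.End K V) v = -v)
    (y : skewAdjointLieSubalgebra B) :
    y ∈ adDegree K x 2 ↔ (∀ v, (y : Module.End K V) v ∈ L) ∧ ∀ v ∈ L, (y : Module.End K V) v = 0 := by
  refine ⟨fun hy ↦ ?_, fun ⟨h1, h2⟩ ↦ mem_adDegree_two_of_apply hLL' x hxL hxL' y h1 h2⟩
  rw [mem_adDegree_iff_apply] at hy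
  -- on `V_1`: `x(y v) = 3 y v`, and `x² = 1` forces `y v = 0`
  have h2 : ∀ v ∈ L, (y : Module.End K V) v = 0 := fun v hv ↦ by
    have h := hy v
    rw [hxL v hv, sub_eq_iff_eq_add] at h
    have h3 : (x : Module.End K V) ((y : Module.End K V) v) = ((2 : K) + 1) • (y : Module.End K V) v := by
      rw [h, add_smul, one_smul]
    have h' := congrArg (x : Module.End K V) h3
    rw [apply_apply_eq_self hLL' (x : Module.End K V) hxL hxL', map_smul, h3, smul_smul] at h'
    have h8 : (((2 : K) + 1) * (2 + 1) - 1) • (y : Module.End K V) v = 0 := by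
      rw [sub_smul, one_smul, ← h', sub_self]
    refine (smul_eq_zero.1 h8).resolve_left ?_
    norm_num
  refine ⟨fun v ↦ ?_, h2⟩
  -- on `V_{-1}`: `x(y v) = y v`, so `y v ∈ V_1`
  have hv₁ := Submodule.projection_apply_mem hLL' v
  have hv₂ := Submodule.projection_apply_mem hLL'.symm v
  rw [← Submodule.projection_add_projection_eq_self hLL' v, map_add, h2 _ hv₁, zero_add,
    mem_left_iff_apply_eq hLL' (x : Module.End K V) hxL hxL']
  have h := hy (L'.projection L hLL'.symm v)
  rw [hxL' _ hv₂, map_neg, sub_neg_eq_add, two_smul, add_right_cancel_iff] at h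
  exact h

/-- **`𝔤_{-2} = {y | y V ⊆ V_{-1}, y V_{-1} = 0}`** (the corner `V_1 → V_{-1}`), from the degree-`2` case for the
opposite splitting (`-h` is `+1` on `V_{-1}`; `𝔤_{-2}(h) = 𝔤_2(-h)`). [cite: LooijengaLunts1997, §2 (2.9) p. 10 L111–L113, p. 11 L6–L8] -/
theorem mem_adDegree_neg_two_iff_apply (hLL' : IsCompl L L') (x : skewAdjointLieSubalgebra B)
    (hxL : ∀ v ∈ L, (x : Module.End K V) v = v) (hxL' : ∀ v ∈ L', (x : Module.End K V) v = -v)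
    (y : skewAdjointLieSubalgebra B) :
    y ∈ adDegree K x (-2) ↔ (∀ v, (y : Module.End K V) v ∈ L') ∧ ∀ v ∈ L', (y : Module.End K V) v = 0 := by
  have h := mem_adDegree_two_iff_apply hLL'.symm (-x)
    (fun v hv ↦ by rw [show ((-x : skewAdjointLieSubalgebra B) : Module.End K V) = -(x : Module.End K V) from rfl,
      LinearMap.neg_apply, hxL' v hv, neg_neg])
    (fun v hv ↦ by rw [show ((-x : skewAdjointLieSubalgebra B) : Module.End K V) = -(x : Module.End K V) from rfl,
      LinearMap.neg_apply, hxL v hv]) y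
  rwa [adDegree_neg] at h

end Positional

/-! ### §10 "`𝔤_{±2}` is naturally isomorphic to the symmetric (resp. skew) elements in `(V_{±1})^{⊗2}`": the form `β_y(a, b) = B(a, y b)` -/

/-- For ANY `y ∈ 𝔰𝔬/𝔰𝔭(V, B)` with `B` `ε`-symmetric, the form `β_y(a, b) = B(a, y b)` is `(-ε)`-symmetric:
symmetric in the symplectic case, skew in the orthogonal case. [cite: LooijengaLunts1997, §2 (2.9) p. 10 L111–L113 ("symmetric elements"), p. 11 L6–L8 ("skew elements")] -/
theorem apply_right_eq_of_mem_skewAdjoint {ε : K} (hε : ∀ u v, B u v = ε * B v u) (y : skewAdjointLieSubalgebra B)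
    (a b : V) : B a ((y : Module.End K V) b) = -ε * B b ((y : Module.End K V) a) := by
  have h := (LinearMap.mem_skewAdjointSubmodule (y : Module.End K V)).1 y.2 a b
  rw [Pi.neg_apply, LinearMap.BilinForm.neg_right] at h
  -- `h : B (y a) b = - B a (y b)`
  rw [hε ((y : Module.End K V) a) b] at h
  rw [neg_mul, h, neg_neg]

section Injective

/-- **`𝔤_2 → {forms on V_{-1}}` is injective**: an element of `𝔤_2` with `B(a, y b) = 0` for all `a, b ∈ V_{-1}`
vanishes (its values lie in the isotropic `V_1`, so they are orthogonal to `V_1` as well, hence to `V`).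
[cite: LooijengaLunts1997, §2 (2.9) p. 10 L111–L113, p. 11 L6–L8] -/
theorem eq_zero_of_apply_mem_of_forall_right (hB : B.Nondegenerate) (hLL' : IsCompl L L')
    (hL : ∀ u ∈ L, ∀ v ∈ L, B u v = 0) (y : skewAdjointLieSubalgebra B) (h1 : ∀ v, (y : Module.End K V) v ∈ L)
    (h2 : ∀ v ∈ L, (y : Module.End K V) v = 0)
    (h0 : ∀ a ∈ L', ∀ b ∈ L', B a ((y : Module.End K V) b) = 0) : y = 0 := by
  apply Subtype.ext
  ext v
  rw [ZeroMemClass.coe_zero, LinearMap.zero_apply, ← Submodule.projection_add_projection_eq_self hLL' v, map_add,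
    h2 _ (Submodule.projection_apply_mem hLL' v), zero_add]
  set v₂ := L'.projection L hLL'.symm v
  have hv₂ : v₂ ∈ L' := Submodule.projection_apply_mem hLL'.symm v
  refine hB.2 _ fun w ↦ ?_
  rw [← Submodule.projection_add_projection_eq_self hLL' w, LinearMap.BilinForm.add_left,
    hL _ (Submodule.projection_apply_mem hLL' w) _ (h1 v₂), h0 _ (Submodule.projection_apply_mem hLL'.symm w) _ hv₂,
    add_zero]

end Injective

section InjectiveDegree

variable [CharZero K]

/-- **`y ↦ β_y` is injective on `𝔤_2`** (characteristic `0`): `y ∈ 𝔤_2` with `B(a, y b) = 0` for all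
`a, b ∈ V_{-1}` is `0`. [cite: LooijengaLunts1997, §2 (2.9) p. 10 L111–L113, p. 11 L6–L8] -/
theorem eq_zero_of_mem_adDegree_two_of_forall_right (hB : B.Nondegenerate) (hLL' : IsCompl L L')
    (hL : ∀ u ∈ L, ∀ v ∈ L, B u v = 0) (x : skewAdjointLieSubalgebra B) (hxL : ∀ v ∈ L, (x : Module.End K V) v = v)
    (hxL' : ∀ v ∈ L', (x : Module.End K V) v = -v) (y : skewAdjointLieSubalgebra B) (hy : y ∈ adDegree K x 2)
    (h0 : ∀ a ∈ L', ∀ b ∈ L', B a ((y : Module.End K V) b) = 0) : y = 0 := by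
  obtain ⟨h1, h2⟩ := (mem_adDegree_two_iff_apply hLL' x hxL hxL' y).1 hy
  exact eq_zero_of_apply_mem_of_forall_right hB hLL' hL y h1 h2 h0

end InjectiveDegree

section Surjective

variable [FiniteDimensional K V]

/-- The RIGHT pairing `V_1 → V_{-1}^*`, `l ↦ B(·, l)|_{V_{-1}}`, is bijective (`B` non-degenerate, `V_1`, `V_{-1}`
complementary totally isotropic). [cite: LooijengaLunts1997, §2 (2.9) p. 11 L11–L12 ("the obvious isomorphism V_{-1} ≅ V_1^*")] -/
theorem bijective_flip_domRestrict₁₂ (hB : B.Nondegenerate) (hLL' : IsCompl L L') (hL : ∀ u ∈ L, ∀ v ∈ L, B u v = 0)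
    (hL' : ∀ u ∈ L', ∀ v ∈ L', B u v = 0) : Bijective (B.flip.domRestrict₁₂ L L') := by
  have hi : Injective (B.flip.domRestrict₁₂ L L') :=
    domRestrict₁₂_injective hB.flip hLL' fun u hu v hv ↦ by rw [LinearMap.BilinForm.flip_apply]; exact hL v hv u hu
  refine ⟨hi, (LinearMap.injective_iff_surjective_of_finrank_eq_finrank ?_).1 hi⟩
  rw [Subspace.dual_finrank_eq, finrank_eq_of_isCompl_isotropic hB hLL' hL hL']

/-- **`𝔤_2 → {(-ε)-symmetric forms on V_{-1}}` is surjective**: every bilinear form `β` on `V_{-1}` with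
`β(a, b) = -ε β(b, a)` is `β(a, b) = B(a, y b)` for some `y ∈ 𝔤_2` — namely `y|_{V_{-1}} = e⁻¹ ∘ β`, `y|_{V_1} = 0`,
with `e : V_1 ≅ V_{-1}^*` the right pairing; skew-adjointness of `y` is exactly the `(-ε)`-symmetry of `β`.
[cite: LooijengaLunts1997, §2 (2.9) p. 10 L111–L113 ("𝔤_{±2} is naturally isomorphic to the space of symmetric elements in (V_{±1})^{⊗2}"), p. 11 L6–L8 ("𝔤_{±2} maps onto the skew elements in (V_{±1})^{⊗2}")] -/
theorem exists_mem_adDegree_two_apply_eq (hB : B.Nondegenerate) {ε : K} (hε : ∀ u v, B u v = ε * B v u)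
    (hLL' : IsCompl L L') (hL : ∀ u ∈ L, ∀ v ∈ L, B u v = 0) (hL' : ∀ u ∈ L', ∀ v ∈ L', B u v = 0)
    (x : skewAdjointLieSubalgebra B) (hxL : ∀ v ∈ L, (x : Module.End K V) v = v)
    (hxL' : ∀ v ∈ L', (x : Module.End K V) v = -v) (β : LinearMap.BilinForm K L')
    (hβ : ∀ a b, β a b = -ε * β b a) :
    ∃ y : skewAdjointLieSubalgebra B, y ∈ adDegree K x 2 ∧ (∀ v, (y : Module.End K V) v ∈ L) ∧
      (∀ v ∈ L, (y : Module.End K V) v = 0) ∧ ∀ a b : L', B a ((y : Module.End K V) b) = β a b := by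
  -- the right pairing `e : L ≅ L'^*`, `e l a = B a l`
  let e : L ≃ₗ[K] Module.Dual K L' := LinearEquiv.ofBijective _ (bijective_flip_domRestrict₁₂ hB hLL' hL hL')
  have he : ∀ (l : L) (a : L'), e l a = B (a : V) l := fun l a ↦ by
    rw [show e l = B.flip.domRestrict₁₂ L L' l from rfl, LinearMap.domRestrict₁₂_apply, LinearMap.BilinForm.flip_apply]
  -- `Y : L' → L`, `B(a, Y b) = β(a, b)`
  let Y : L' →ₗ[K] L := e.symm.toLinearMap ∘ₗ β.flip
  have hY : ∀ a b : L', B (a : V) (Y b) = β a b := fun a b ↦ by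
    rw [← he, show Y b = e.symm (β.flip b) from rfl, LinearEquiv.apply_symm_apply, LinearMap.BilinForm.flip_apply]
  let P' : V →ₗ[K] L' := L'.projectionOnto L hLL'.symm
  let y : Module.End K V := L.subtype ∘ₗ Y ∘ₗ P'
  have hyapp : ∀ v, y v = (Y (P' v) : V) := fun v ↦ rfl
  have hP'l : ∀ v ∈ L, P' v = 0 := fun v hv ↦ Submodule.projectionOnto_apply_right hLL'.symm ⟨v, hv⟩
  have hP'l' : ∀ b : L', P' b = b := fun b ↦ Submodule.projectionOnto_apply_left hLL'.symm b
  have hy1 : ∀ v, y v ∈ L := fun v ↦ (Y (P' v)).2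
  have hy2 : ∀ v ∈ L, y v = 0 := fun v hv ↦ by rw [hyapp, hP'l v hv, map_zero, ZeroMemClass.coe_zero]
  have hyb : ∀ b : L', y b = Y b := fun b ↦ by rw [hyapp, hP'l']
  have hdec : ∀ v : V, (L.projection L' hLL' v) + ((P' v : L') : V) = v := fun v ↦
    Submodule.projection_add_projection_eq_self hLL' v
  -- `y` is skew-adjoint
  have hymem : y ∈ skewAdjointLieSubalgebra B := by
    show y ∈ B.skewAdjointSubmodule
    rw [LinearMap.mem_skewAdjointSubmodule]
    intro v w
    rw [Pi.neg_apply, LinearMap.BilinForm.neg_right]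
    have hv₁ := Submodule.projection_apply_mem hLL' v
    have hw₁ := Submodule.projection_apply_mem hLL' w
    conv_lhs => rw [← hdec w]
    conv_rhs => rw [← hdec v]
    rw [LinearMap.BilinForm.add_right, hL _ (hy1 v) _ hw₁, zero_add, LinearMap.BilinForm.add_left,
      hL _ hv₁ _ (hy1 w), zero_add, hyapp, hyapp, hε (Y (P' v) : V), hY, hY, hβ (P' v) (P' w)]
    ring
  refine ⟨⟨y, hymem⟩, mem_adDegree_two_of_apply hLL' x hxL hxL' ⟨y, hymem⟩ hy1 hy2, hy1, hy2, fun a b ↦ ?_⟩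
  change B (a : V) (y b) = β a b
  rw [hyb, hY]

end Surjective

section Iso

variable [CharZero K] [FiniteDimensional K V]

/-- **"`𝔤_2` is naturally isomorphic to the `(-ε)`-symmetric elements of `(V_1)^{⊗2}`"**, rendered as: `y ↦ β_y =
B(·, y ·)|_{V_{-1} × V_{-1}}` is a bijection from `𝔤_2` onto the bilinear forms `β` on `V_{-1}` with
`β(a, b) = -ε β(b, a)` (through `V_{-1} ≅ V_1^*` these are the `(-ε)`-symmetric tensors in `V_1 ⊗ V_1`).
[cite: LooijengaLunts1997, §2 (2.9) p. 10 L111–L113, p. 11 L6–L8, L11–L12] -/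
theorem existsUnique_mem_adDegree_two_apply_eq (hB : B.Nondegenerate) {ε : K} (hε : ∀ u v, B u v = ε * B v u)
    (hLL' : IsCompl L L') (hL : ∀ u ∈ L, ∀ v ∈ L, B u v = 0) (hL' : ∀ u ∈ L', ∀ v ∈ L', B u v = 0)
    (x : skewAdjointLieSubalgebra B) (hxL : ∀ v ∈ L, (x : Module.End K V) v = v)
    (hxL' : ∀ v ∈ L', (x : Module.End K V) v = -v) (β : LinearMap.BilinForm K L')
    (hβ : ∀ a b, β a b = -ε * β b a) :
    ∃! y : skewAdjointLieSubalgebra B, y ∈ adDegree K x 2 ∧ ∀ a b : L', B a ((y : Module.End K V) b) = β a b := by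
  obtain ⟨y, hy, hy1, hy2, hyβ⟩ := exists_mem_adDegree_two_apply_eq hB hε hLL' hL hL' x hxL hxL' β hβ
  refine ⟨y, ⟨hy, hyβ⟩, fun y' ⟨hy', hy'β⟩ ↦ ?_⟩
  rw [← sub_eq_zero]
  refine eq_zero_of_mem_adDegree_two_of_forall_right hB hLL' hL x hxL hxL' (y' - y) (Submodule.sub_mem _ hy' hy)
    fun a ha b hb ↦ ?_
  rw [show ((y' - y : skewAdjointLieSubalgebra B) : Module.End K V) = (y' : Module.End K V) - y from rfl,
    LinearMap.sub_apply, LinearMap.BilinForm.sub_right, sub_eq_zero]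
  exact (hy'β ⟨a, ha⟩ ⟨b, hb⟩).trans (hyβ ⟨a, ha⟩ ⟨b, hb⟩).symm

/-- **Case `(C_m, A_{m-1})`: `𝔤_2 ≅ Sym²(V_1)`** — for `B` alternating, `𝔤_2` corresponds bijectively to the
SYMMETRIC bilinear forms on `V_{-1}`. [cite: LooijengaLunts1997, §2 (2.9) p. 10 L111–L113 ("𝔤_{±2} is naturally isomorphic to the space of symmetric elements in (V_{±1})^{⊗2}")] -/
theorem existsUnique_mem_adDegree_two_apply_eq_of_isAlt (hB : B.Nondegenerate) (halt : B.IsAlt)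
    (hLL' : IsCompl L L') (hL : ∀ u ∈ L, ∀ v ∈ L, B u v = 0) (hL' : ∀ u ∈ L', ∀ v ∈ L', B u v = 0)
    (x : skewAdjointLieSubalgebra B) (hxL : ∀ v ∈ L, (x : Module.End K V) v = v)
    (hxL' : ∀ v ∈ L', (x : Module.End K V) v = -v) (β : LinearMap.BilinForm K L') (hβ : ∀ a b, β a b = β b a) :
    ∃! y : skewAdjointLieSubalgebra B, y ∈ adDegree K x 2 ∧ ∀ a b : L', B a ((y : Module.End K V) b) = β a b :=
  existsUnique_mem_adDegree_two_apply_eq hB (ε := -1) (fun u v ↦ by rw [← halt.neg_eq, neg_one_mul]) hLL' hL hL' x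
    hxL hxL' β fun a b ↦ by rw [neg_neg, one_mul]; exact hβ a b

/-- **Case `(D_{2m}, A_{2m-1})`: `𝔤_2 ≅ Λ²(V_1)`** — for `B` symmetric, `𝔤_2` corresponds bijectively to the SKEW
bilinear forms on `V_{-1}`. [cite: LooijengaLunts1997, §2 (2.9) p. 11 L6–L8 ("𝔤_{±2} maps onto the skew elements in (V_{±1})^{⊗2}")] -/
theorem existsUnique_mem_adDegree_two_apply_eq_of_isSymm (hB : B.Nondegenerate) (hs : ∀ u v : V, B u v = B v u)
    (hLL' : IsCompl L L') (hL : ∀ u ∈ L, ∀ v ∈ L, B u v = 0) (hL' : ∀ u ∈ L', ∀ v ∈ L', B u v = 0)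
    (x : skewAdjointLieSubalgebra B) (hxL : ∀ v ∈ L, (x : Module.End K V) v = v)
    (hxL' : ∀ v ∈ L', (x : Module.End K V) v = -v) (β : LinearMap.BilinForm K L') (hβ : ∀ a b, β a b = -β b a) :
    ∃! y : skewAdjointLieSubalgebra B, y ∈ adDegree K x 2 ∧ ∀ a b : L', B a ((y : Module.End K V) b) = β a b :=
  existsUnique_mem_adDegree_two_apply_eq hB (ε := 1) (fun u v ↦ by rw [one_mul]; exact hs u v) hLL' hL hL' x hxL hxL'
    β fun a b ↦ by rw [neg_one_mul]; exact hβ a b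

/-- **The same for `𝔤_{-2}` and forms on `V_1`** (swap the roles of `V_1`, `V_{-1}`: `-h` grades the opposite
splitting and `𝔤_{-2}(h) = 𝔤_2(-h)`). [cite: LooijengaLunts1997, §2 (2.9) p. 10 L111–L113, p. 11 L6–L8] -/
theorem existsUnique_mem_adDegree_neg_two_apply_eq (hB : B.Nondegenerate) {ε : K} (hε : ∀ u v, B u v = ε * B v u)
    (hLL' : IsCompl L L') (hL : ∀ u ∈ L, ∀ v ∈ L, B u v = 0) (hL' : ∀ u ∈ L', ∀ v ∈ L', B u v = 0)
    (x : skewAdjointLieSubalgebra B) (hxL : ∀ v ∈ L, (x : Module.End K V) v = v)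
    (hxL' : ∀ v ∈ L', (x : Module.End K V) v = -v) (β : LinearMap.BilinForm K L)
    (hβ : ∀ a b, β a b = -ε * β b a) :
    ∃! y : skewAdjointLieSubalgebra B, y ∈ adDegree K x (-2) ∧ ∀ a b : L, B a ((y : Module.End K V) b) = β a b := by
  have h := existsUnique_mem_adDegree_two_apply_eq hB hε hLL'.symm hL' hL (-x)
    (fun v hv ↦ by rw [show ((-x : skewAdjointLieSubalgebra B) : Module.End K V) = -(x : Module.End K V) from rfl,
      LinearMap.neg_apply, hxL' v hv, neg_neg])
    (fun v hv ↦ by rw [show ((-x : skewAdjointLieSubalgebra B) : Module.End K V) = -(x : Module.End K V) from rfl,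
      LinearMap.neg_apply, hxL v hv]) β hβ
  rwa [adDegree_neg] at h

end Iso

end Literature.Algebra.Lie.LagrangianSplittingGrading
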